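import Summits.KontsevichZagierPeriods.KontsevichZagierPeriods.Theses.HermiteRigidity
import Literature.NumberTheory.Transcendental.KZSubcalculusInvariants
import Literature.NumberTheory.Transcendental.KZRelationsLE
import Literature.NumberTheory.Transcendental.KZLogCalculusProofs

/-!
# Sketch — crux-ideate stmt-KontsevichZagierPeriods-10632 (`HermiteRigidity.RealEllipticSectorKernel`),
round 1, ideator 1.

First lemmas of the two idea cards `rigidity-splits-kernel` and `oval-hermite-engine`, stated over
existing declarations (route decls + `Literature.NumberTheory.Transcendental.KZ.*`). PROVED here
(11, axioms = propext/choice/Quot.sound only): `reflectionTransport` — THE FIRST LEMMA OF CARD 1: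
one σ′-generator of the crux differs by ONE `changeOfVariablesRel` instance (Φ = −id on ℝ¹,
|det| = 1 via `det_neg_id_fin_one`) plus a free cancellation from (−1)^m times a 1-dim generator
of `EllipticMomentKernel` at (q₂, −q₃); `sigma'_eq_image_neg` (σ′(f) = −σ(f⁻) as typed sets),
`twist_integrand`, `twist_values` (K_m = (−1)^m J̃_m at value level, measure-preserving
negation), `satelliteCollapse` (a family sharing domain + integrand is cyclic mod relations,
coefficient `KZ.coeffSum`), `rigiditySplits`, `kernel_sigma_of_EMK` (the σ-block kernel is
`EllipticMomentKernel` restricted), `H3_of_H5`, `H3twist_of_H5`, `monomial_certificate` (general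
cubic). Remaining `sorry`s (3): `stub_valueSpan` (analysis), `stub_ovalExactForm`,
`stub_ovalReduction` (card 2's engine) — by design (crux-ideate files no skeleton).
-/

namespace Summit.KontsevichZagierPeriods.KontsevichZagierPeriods.Cruxes.RealEllipticSectorKernel.Ideate1

open Set MeasureTheory
open Literature.NumberTheory.Transcendental
open Summit.KontsevichZagierPeriods.KontsevichZagierPeriods.Theses.HermiteRigidity

/-! ## Card `rigidity-splits-kernel` -/

/-- PROVED. The twist involution `x ↦ -x`, `q₃ ↦ -q₃` exchanges the TYPED definitions of the
crux's `σ'` (for `f = 4x³ - q₂x - q₃`) and of `EllipticMomentKernel`'s `σ` (for the twist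
`g = 4x³ - q₂x + q₃`) on the nose: `σ'(f) = -σ(g)`. No root is named. -/
theorem sigma'_eq_image_neg (q₂ q₃ : ℝ) :
    {p : Fin 1 → ℝ | 4 * p 0 ^ 3 - q₂ * p 0 - q₃ < 0 ∧ ∃ t : ℝ, t < p 0 ∧ 0 < 4 * t ^ 3 - q₂ * t - q₃}
      = (fun u : Fin 1 → ℝ => -u) ''
        {u : Fin 1 → ℝ | 0 < 4 * u 0 ^ 3 - q₂ * u 0 + q₃ ∧ ∃ t : ℝ, u 0 < t ∧ 4 * t ^ 3 - q₂ * t + q₃ < 0} := by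
  ext p
  simp only [mem_setOf_eq, mem_image]
  constructor
  · rintro ⟨hp, t, ht, hft⟩
    refine ⟨-p, ⟨?_, -t, ?_, ?_⟩, neg_neg p⟩
    · have h : 4 * (-p) 0 ^ 3 - q₂ * (-p) 0 + q₃ = -(4 * p 0 ^ 3 - q₂ * p 0 - q₃) := by
        simp only [Pi.neg_apply]; ring
      rw [h]; linarith
    · simp only [Pi.neg_apply]; linarith
    · have h : 4 * (-t) ^ 3 - q₂ * (-t) + q₃ = -(4 * t ^ 3 - q₂ * t - q₃) := by ring
      rw [h]; linarith
  · rintro ⟨u, ⟨hu, t, ht, hgt⟩, rfl⟩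
    refine ⟨?_, -t, ?_, ?_⟩
    · have h : 4 * (-u) 0 ^ 3 - q₂ * (-u) 0 - q₃ = -(4 * u 0 ^ 3 - q₂ * u 0 + q₃) := by
        simp only [Pi.neg_apply]; ring
      rw [h]; linarith
    · simp only [Pi.neg_apply]; linarith
    · have h : 4 * (-t) ^ 3 - q₂ * (-t) - q₃ = -(4 * t ^ 3 - q₂ * t + q₃) := by ring
      rw [h]; linarith

/-- PROVED. The integrand side of the same involution: `(-u)^m / √(-f(-u)) = (-1)^m u^m / √(g u)`. -/
theorem twist_integrand (q₂ q₃ u : ℝ) (m : ℕ) :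
    (-u) ^ m / Real.sqrt (-(4 * (-u) ^ 3 - q₂ * (-u) - q₃))
      = (-1) ^ m * (u ^ m / Real.sqrt (4 * u ^ 3 - q₂ * u + q₃)) := by
  have h : -(4 * (-u) ^ 3 - q₂ * (-u) - q₃) = 4 * u ^ 3 - q₂ * u + q₃ := by ring
  rw [h, neg_pow, mul_div_assoc]

/-- PROVED. VALUE-LEVEL REFLECTION: the `σ'`-moments of `f` are `(-1)^m` times the `σ`-moments of
the twist `(q₂, -q₃)` (in particular `K₀ = J̃₀`, `K₁ = -J̃₁`, the inputs of `H3twist_of_H5`).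
Proof pattern = the disprover's `K₀_eq_J₀_of_q₃_eq_zero` (F5): `x ↦ -x` preserves Lebesgue measure. -/
theorem twist_values (q₂ q₃ : ℚ) (m : ℕ) :
    let f : ℝ → ℝ := fun x => 4 * x ^ 3 - (q₂ : ℝ) * x - (q₃ : ℝ)
    let g : ℝ → ℝ := fun x => 4 * x ^ 3 - (q₂ : ℝ) * x - ((-q₃ : ℚ) : ℝ)
    let σ' : Set (Fin 1 → ℝ) := {p | f (p 0) < 0 ∧ ∃ t : ℝ, t < p 0 ∧ 0 < f t}
    let σg : Set (Fin 1 → ℝ) := {p | 0 < g (p 0) ∧ ∃ t : ℝ, p 0 < t ∧ g t < 0}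
    (∫ p in σ', p 0 ^ m / Real.sqrt (-f (p 0)))
      = (-1) ^ m * ∫ p in σg, p 0 ^ m / Real.sqrt (g (p 0)) := by
  intro f g σ' σg
  haveI : (volume : Measure (Fin 1 → ℝ)).IsNegInvariant :=
    Measure.IsAddHaarMeasure.isNegInvariant_of_regular _
  have hN : MeasurePreserving (fun p : Fin 1 → ℝ => -p) volume volume :=
    Measure.measurePreserving_neg _
  have hemb : MeasurableEmbedding (fun p : Fin 1 → ℝ => -p) :=
    (MeasurableEquiv.neg (Fin 1 → ℝ)).measurableEmbedding
  have hg : ∀ x : ℝ, g x = 4 * x ^ 3 - (q₂ : ℝ) * x + (q₃ : ℝ) := fun x => by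
    simp only [g, Rat.cast_neg]; ring
  -- `σ'` is the preimage of `σg` under negation (the set identity, with the cast bridge)
  have hpre : σ' = (fun p : Fin 1 → ℝ => -p) ⁻¹' σg := by
    have h1 : σ' = {p : Fin 1 → ℝ | 4 * p 0 ^ 3 - (q₂ : ℝ) * p 0 - (q₃ : ℝ) < 0 ∧
        ∃ t : ℝ, t < p 0 ∧ 0 < 4 * t ^ 3 - (q₂ : ℝ) * t - (q₃ : ℝ)} := rfl
    have h2 : σg = {u : Fin 1 → ℝ | 0 < 4 * u 0 ^ 3 - (q₂ : ℝ) * u 0 + (q₃ : ℝ) ∧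
        ∃ t : ℝ, u 0 < t ∧ 4 * t ^ 3 - (q₂ : ℝ) * t + (q₃ : ℝ) < 0} := by
      ext u; simp only [σg, mem_setOf_eq, hg]
    rw [h1, sigma'_eq_image_neg, h2, Set.image_eq_preimage_of_inverse neg_neg neg_neg]
  have key := hN.setIntegral_preimage_emb hemb (fun u => u 0 ^ m / Real.sqrt (g (u 0)) * (-1) ^ m) σg
  rw [hpre]
  have hint : (fun p : Fin 1 → ℝ => p 0 ^ m / Real.sqrt (-f (p 0)))
      = fun p => (fun u : Fin 1 → ℝ => u 0 ^ m / Real.sqrt (g (u 0)) * (-1) ^ m) (-p) := by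
    funext p
    have h := twist_integrand (q₂ : ℝ) (q₃ : ℝ) ((-p) 0) m
    simp only [Pi.neg_apply, neg_neg] at h
    simp only [Pi.neg_apply, f, hg]
    rw [h]; ring
  rw [hint, key, integral_mul_const]
  ring

/-- The determinant of `-id` on `ℝ¹` is `-1`. -/
theorem det_neg_id_fin_one : (-ContinuousLinearMap.id ℝ (Fin 1 → ℝ)).det = -1 := by
  have h1 : ((-ContinuousLinearMap.id ℝ (Fin 1 → ℝ) : (Fin 1 → ℝ) →L[ℝ] (Fin 1 → ℝ)) :
      (Fin 1 → ℝ) →ₗ[ℝ] (Fin 1 → ℝ)) = (-1 : ℝ) • LinearMap.id := by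
    ext x i; simp
  unfold ContinuousLinearMap.det
  rw [h1, LinearMap.det_smul, LinearMap.det_id, Module.finrank_fin_fun]
  norm_num

/-- PROVED (first lemma of `rigidity-splits-kernel`). REFLECTION TRANSPORT of one `σ'`-generator:
a representation of `x^m dx/√(-f)` on `σ'(f)` differs by ONE rule-2 move (`Φ = -id`, `|det| = 1`)
and, for odd `m`, one free cancellation (`KZ.of_add_of_neg_mem_levelRel`) from `(-1)^m`
times a generator of `EllipticMomentKernel`'s 1-dimensional family for the twist `(q₂, -q₃)`.
No Tarski–Seidenberg beyond the tree's composition lemma; no root is named. -/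
theorem reflectionTransport (q₂ q₃ : ℚ) (m : ℕ) :
    let f : ℝ → ℝ := fun x => 4 * x ^ 3 - (q₂ : ℝ) * x - (q₃ : ℝ)
    let g : ℝ → ℝ := fun x => 4 * x ^ 3 - (q₂ : ℝ) * x - ((-q₃ : ℚ) : ℝ)
    let σ' : Set (Fin 1 → ℝ) := {p | f (p 0) < 0 ∧ ∃ t : ℝ, t < p 0 ∧ 0 < f t}
    let σg : Set (Fin 1 → ℝ) := {p | 0 < g (p 0) ∧ ∃ t : ℝ, p 0 < t ∧ g t < 0}
    ∀ r : KZ.IntegralRep 1, r.domain = σ' →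
      EqOn r.integrand (fun p => p 0 ^ m / Real.sqrt (-f (p 0))) σ' →
      ∃ s : KZ.IntegralRep 1, s.domain = σg ∧
        EqOn s.integrand (fun p => p 0 ^ m / Real.sqrt (g (p 0))) σg ∧
        KZ.of r - ((-1 : ℤ) ^ m) • KZ.of s ∈ KZ.relations := by
  intro f g σ' σg r hrd hri
  have hg : ∀ x : ℝ, g x = 4 * x ^ 3 - (q₂ : ℝ) * x + (q₃ : ℝ) := fun x => by
    simp only [g, Rat.cast_neg]; ring
  have hσ'def : σ' = {p : Fin 1 → ℝ | 4 * p 0 ^ 3 - (q₂ : ℝ) * p 0 - (q₃ : ℝ) < 0 ∧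
      ∃ t : ℝ, t < p 0 ∧ 0 < 4 * t ^ 3 - (q₂ : ℝ) * t - (q₃ : ℝ)} := rfl
  have hσgdef : σg = {u : Fin 1 → ℝ | 0 < 4 * u 0 ^ 3 - (q₂ : ℝ) * u 0 + (q₃ : ℝ) ∧
      ∃ t : ℝ, u 0 < t ∧ 4 * t ^ 3 - (q₂ : ℝ) * t + (q₃ : ℝ) < 0} := by
    ext u; simp only [σg, mem_setOf_eq, hg]
  have himage : (fun u : Fin 1 → ℝ => -u) '' σg = σ' := by
    rw [hσ'def, hσgdef, sigma'_eq_image_neg]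
  have hpre : σg = (fun p : Fin 1 → ℝ => -p) ⁻¹' σ' := by
    rw [← himage, Set.preimage_image_eq _ neg_injective]
  -- the polynomial map `x ↦ -x`
  have hnegMap : ∀ {s : Set (Fin 1 → ℝ)}, Literature.ModelTheory.ExponentialFields.IsSemialgebraic ℚ s →
      IsSemialgebraicMapOn ℚ s (fun p : Fin 1 → ℝ => -p) := by
    intro s hs
    refine (isSemialgebraicMapOn_aeval hs
      (fun j : Fin 1 => (-(MvPolynomial.X j) : MvPolynomial (Fin 1) ℚ))).congr ?_
    intro x _
    funext j
    simp
  have hσ' : Literature.ModelTheory.ExponentialFields.IsSemialgebraic ℚ σ' := hrd ▸ r.isSemialgebraic_domain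
  have hσg : Literature.ModelTheory.ExponentialFields.IsSemialgebraic ℚ σg := by
    have h := hσ'.preimage_aeval (fun j : Fin 1 => (-(MvPolynomial.X j) : MvPolynomial (Fin 1) ℚ))
    rw [hpre]
    convert h using 1
    ext u
    simp only [mem_preimage]
    congr! 1
    funext j
    simp
  -- the reflected representation `s₀ = [σg, r.integrand ∘ neg]`
  have hmaps : MapsTo (fun u : Fin 1 → ℝ => -u) σg r.domain := by
    rw [hrd, hpre]; exact fun u hu => hu
  have hsa : IsSemialgebraicFunOn ℚ σg (r.integrand ∘ fun u : Fin 1 → ℝ => -u) :=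
    IsSemialgebraicFunOn.comp_isSemialgebraicMapOn_holds r.isSemialgebraicFunOn_integrand
      (hnegMap hσg) hmaps
  haveI : (volume : Measure (Fin 1 → ℝ)).IsNegInvariant :=
    Measure.IsAddHaarMeasure.isNegInvariant_of_regular _
  have hN : MeasurePreserving (fun p : Fin 1 → ℝ => -p) volume volume :=
    Measure.measurePreserving_neg _
  have hemb : MeasurableEmbedding (fun p : Fin 1 → ℝ => -p) :=
    (MeasurableEquiv.neg (Fin 1 → ℝ)).measurableEmbedding
  have hint : IntegrableOn (r.integrand ∘ fun u : Fin 1 → ℝ => -u) σg := by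
    rw [hpre, ← hrd]
    exact (hN.integrableOn_comp_preimage hemb).2 r.integrableOn
  set s₀ : KZ.IntegralRep 1 := ⟨σg, r.integrand ∘ fun u : Fin 1 → ℝ => -u, hσg, hsa, hint⟩ with hs₀def
  -- the change-of-variables move `[r] - [s₀]`
  have hcov : KZ.of r - KZ.of s₀ ∈ KZ.relations := by
    refine KZ.changeOfVariablesRel_subset_relations
      ⟨1, r, s₀, fun p => -p, fun _ => -ContinuousLinearMap.id ℝ (Fin 1 → ℝ),
        hnegMap r.isSemialgebraic_domain, fun x _ => (hasFDerivWithinAt_id x _).neg,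
        neg_injective.injOn, ?_, fun x _ => ?_, rfl⟩
    · show σg = (fun p : Fin 1 → ℝ => -p) '' r.domain
      rw [hrd, ← himage, Set.image_image]
      simp
    · rw [det_neg_id_fin_one]
      show r.integrand x = r.integrand (-(-x)) * |(-1 : ℝ)|
      simp
  -- values of `s₀` on `σg`
  have hs₀ : EqOn s₀.integrand (fun u => (-1) ^ m * (u 0 ^ m / Real.sqrt (g (u 0)))) σg := by
    intro u hu
    have hu' : -u ∈ σ' := by rw [hpre] at hu; exact hu
    show r.integrand (-u) = _
    rw [hri hu']
    have h := twist_integrand (q₂ : ℝ) (q₃ : ℝ) (u 0) m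
    simp only [Pi.neg_apply, f, hg]
    exact h
  -- parity split: `s = s₀` for even `m`, `s = s₀.neg` for odd `m`
  rcases Nat.even_or_odd m with hm | hm
  · refine ⟨s₀, rfl, fun u hu => ?_, ?_⟩
    · show s₀.integrand u = u 0 ^ m / Real.sqrt (g (u 0))
      rw [hs₀ hu]
      simp only [hm.neg_one_pow, one_mul]
    · rw [hm.neg_one_pow, one_smul]; exact hcov
  · refine ⟨s₀.neg, rfl, fun u hu => ?_, ?_⟩
    · show -s₀.integrand u = u 0 ^ m / Real.sqrt (g (u 0))
      rw [hs₀ hu]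
      simp only [hm.neg_one_pow]
      ring
    · rw [hm.neg_one_pow, neg_smul, one_smul, sub_neg_eq_add]
      have h2 : KZ.of s₀ + KZ.of s₀.neg ∈ KZ.relations :=
        KZ.levelRel_le_relations (KZ.of_add_of_neg_mem_levelRel s₀)
      have : KZ.of r + KZ.of s₀.neg = (KZ.of r - KZ.of s₀) + (KZ.of s₀ + KZ.of s₀.neg) := by abel
      rw [this]
      exact KZ.relations.add_mem hcov h2

/-- STUB (M, pure real analysis — or soundness ∘ `HermiteExactFormVanishes`). VALUE SPAN on the
bounded oval: every moment `J_m = ∫_σ x^m/√f` is a ℚ-combination of `J₀, J₁` (the rational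
coefficients come from the recurrence `(4k+6) J_{k+2} = q₂ (k+½) J_k + q₃ k J_{k-1}`). Applied to
`(q₂, -q₃)` and transported by `x ↦ -x` it gives the `σ'`-span `K_m ∈ ℚK₀ + ℚK₁` for free. -/
theorem stub_valueSpan (q₂ q₃ : ℚ) (hΔ : 0 < (q₂ : ℝ) ^ 3 - 27 * (q₃ : ℝ) ^ 2) (m : ℕ) :
    let f : ℝ → ℝ := fun x => 4 * x ^ 3 - (q₂ : ℝ) * x - (q₃ : ℝ)
    let σ : Set (Fin 1 → ℝ) := {p | 0 < f (p 0) ∧ ∃ t : ℝ, p 0 < t ∧ f t < 0}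
    ∃ a b : ℚ, (∫ p in σ, p 0 ^ m / Real.sqrt (f (p 0)))
      = a * (∫ p in σ, 1 / Real.sqrt (f (p 0))) + b * (∫ p in σ, p 0 / Real.sqrt (f (p 0))) := by
  sorry

/-- PROVED (closure induction + `KZ.of_sub_of_mem_relations_of_eqOn`). COLLAPSE of a satellite
family: representations sharing one domain and one integrand-on-the-domain generate a subgroup that
is cyclic modulo relations, with generator any member and coefficient `KZ.coeffSum`.
Used for `σ''` (then ONE `TwoTorsionTransfer` moves the generator onto `σ`). -/
theorem satelliteCollapse {n : ℕ} (D : Set (Fin n → ℝ)) (φ : (Fin n → ℝ) → ℝ)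
    (r₀ : KZ.IntegralRep n) (h₀ : r₀.domain = D) (h₀' : EqOn r₀.integrand φ D) :
    ∀ c ∈ AddSubgroup.closure
        {x : KZ.FormalRep | ∃ r : KZ.IntegralRep n, r.domain = D ∧ EqOn r.integrand φ D ∧ x = KZ.of r},
      c - (KZ.coeffSum c) • KZ.of r₀ ∈ KZ.relations := by
  intro c hc
  refine AddSubgroup.closure_induction (p := fun c _ => c - (KZ.coeffSum c) • KZ.of r₀ ∈ KZ.relations)
    ?_ ?_ ?_ ?_ hc
  · rintro x ⟨r, hr, hrφ, rfl⟩
    rw [KZ.coeffSum_of, one_smul]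
    refine KZ.of_sub_of_mem_relations_of_eqOn (by rw [h₀, hr]) (fun p hp => ?_)
    rw [hr] at hp
    rw [hrφ hp, h₀' hp]
  · simp [KZ.relations.zero_mem]
  · intro x y _ _ hx hy
    have : x + y - KZ.coeffSum (x + y) • KZ.of r₀
        = (x - KZ.coeffSum x • KZ.of r₀) + (y - KZ.coeffSum y • KZ.of r₀) := by
      rw [map_add, add_smul]; abel
    rw [this]
    exact KZ.relations.add_mem hx hy
  · intro x _ hx
    have : -x - KZ.coeffSum (-x) • KZ.of r₀ = -(x - KZ.coeffSum x • KZ.of r₀) := by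
      rw [map_neg, neg_smul]; abel
    rw [this]
    exact KZ.relations.neg_mem hx

/-- PROVED (linear algebra over the inlined hypothesis). RIGIDITY SPLITS THE KERNEL: under the
crux's independence hypothesis, a vanishing sum of a `ℚJ₀ + ℚJ₁`-value and a `ℚK₀ + ℚK₁`-value has
both summands zero. (Stated over reals `J₀ J₁ K₀ K₁` to keep it hypothesis-shaped.) -/
theorem rigiditySplits (J₀ J₁ K₀ K₁ : ℝ)
    (hind : ∀ a b c d e : ℝ, IsAlgebraic ℚ a → IsAlgebraic ℚ b → IsAlgebraic ℚ c → IsAlgebraic ℚ d →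
      IsAlgebraic ℚ e → a + b * J₀ + c * J₁ + d * K₀ + e * K₁ = 0 → a = 0 ∧ b = 0 ∧ c = 0 ∧ d = 0 ∧ e = 0)
    (b c d e : ℚ) (h : (b * J₀ + c * J₁) + (d * K₀ + e * K₁) = 0) :
    b * J₀ + c * J₁ = 0 ∧ d * K₀ + e * K₁ = 0 := by
  have h' : (0 : ℝ) + b * J₀ + c * J₁ + d * K₀ + e * K₁ = 0 := by linarith
  have hq : ∀ q : ℚ, IsAlgebraic ℚ (q : ℝ) := fun q => by
    simpa [eq_ratCast] using isAlgebraic_algebraMap (R := ℚ) (A := ℝ) q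
  obtain ⟨-, hb, hc, hd, he⟩ := hind 0 b c d e isAlgebraic_zero (hq b) (hq c) (hq d) (hq e) h'
  refine ⟨?_, ?_⟩
  · rw [hb, hc]; ring
  · rw [hd, he]; ring

/-- PROVED. The `σ`-block kernel IS the rank-3 crux `EllipticMomentKernel` restricted to its
1-dimensional generators (`AddSubgroup.closure_mono` on the second component of its family):
no new move-level work on `σ`. -/
theorem kernel_sigma_of_EMK (hE : EllipticMomentKernel) (q₂ q₃ : ℚ)
    (hΔ : 0 < (q₂ : ℝ) ^ 3 - 27 * (q₃ : ℝ) ^ 2) :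
    let f : ℝ → ℝ := fun x => 4 * x ^ 3 - (q₂ : ℝ) * x - (q₃ : ℝ)
    let σ : Set (Fin 1 → ℝ) := {p | 0 < f (p 0) ∧ ∃ t : ℝ, p 0 < t ∧ f t < 0}
    (∀ a b c : ℝ, IsAlgebraic ℚ a → IsAlgebraic ℚ b → IsAlgebraic ℚ c →
      a + b * (∫ p in σ, 1 / Real.sqrt (f (p 0))) + c * (∫ p in σ, p 0 / Real.sqrt (f (p 0))) = 0 →
      a = 0 ∧ b = 0 ∧ c = 0) →
    ∀ c ∈ AddSubgroup.closure {c : KZ.FormalRep | ∃ (r : KZ.IntegralRep 1) (m : ℕ), r.domain = σ ∧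
        EqOn r.integrand (fun p => p 0 ^ m / Real.sqrt (f (p 0))) σ ∧ c = KZ.of r},
      KZ.eval c = 0 → c ∈ KZ.relations := by
  intro f σ hind c hc h0
  exact hE q₂ q₃ hΔ hind c (AddSubgroup.closure_mono Set.subset_union_right hc) h0

/-- PROVED. HYPOTHESIS TRANSFER: the crux's five-slot independence `H5` contains the three-slot
hypothesis of `EllipticMomentKernel (q₂, q₃)` (slots `d = e = 0`) … -/
theorem H3_of_H5 (J₀ J₁ K₀ K₁ : ℝ)
    (hind : ∀ a b c d e : ℝ, IsAlgebraic ℚ a → IsAlgebraic ℚ b → IsAlgebraic ℚ c → IsAlgebraic ℚ d →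
      IsAlgebraic ℚ e → a + b * J₀ + c * J₁ + d * K₀ + e * K₁ = 0 → a = 0 ∧ b = 0 ∧ c = 0 ∧ d = 0 ∧ e = 0) :
    ∀ a b c : ℝ, IsAlgebraic ℚ a → IsAlgebraic ℚ b → IsAlgebraic ℚ c →
      a + b * J₀ + c * J₁ = 0 → a = 0 ∧ b = 0 ∧ c = 0 := by
  intro a b c ha hb hc h
  obtain ⟨h1, h2, h3, -, -⟩ := hind a b c 0 0 ha hb hc isAlgebraic_zero isAlgebraic_zero (by simpa using h)
  exact ⟨h1, h2, h3⟩

/-- PROVED. … and, given the VALUE-level reflection identities `J̃₀ = K₀`, `J̃₁ = -K₁` for the twist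
`(q₂, -q₃)` (substitution `x = -u` in two real integrals), the three-slot hypothesis of
`EllipticMomentKernel (q₂, -q₃)`. -/
theorem H3twist_of_H5 (J₀ J₁ K₀ K₁ Jt₀ Jt₁ : ℝ) (h₀ : Jt₀ = K₀) (h₁ : Jt₁ = -K₁)
    (hind : ∀ a b c d e : ℝ, IsAlgebraic ℚ a → IsAlgebraic ℚ b → IsAlgebraic ℚ c → IsAlgebraic ℚ d →
      IsAlgebraic ℚ e → a + b * J₀ + c * J₁ + d * K₀ + e * K₁ = 0 → a = 0 ∧ b = 0 ∧ c = 0 ∧ d = 0 ∧ e = 0) :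
    ∀ a b c : ℝ, IsAlgebraic ℚ a → IsAlgebraic ℚ b → IsAlgebraic ℚ c →
      a + b * Jt₀ + c * Jt₁ = 0 → a = 0 ∧ b = 0 ∧ c = 0 := by
  intro a b c ha hb hc h
  subst h₀ h₁
  obtain ⟨h1, -, -, h4, h5⟩ :=
    hind a 0 0 b (-c) ha isAlgebraic_zero isAlgebraic_zero hb hc.neg (by linear_combination h)
  exact ⟨h1, h4, by linear_combination -h5⟩

/-! ## Card `oval-hermite-engine` -/

/-- PROVED. The monomial Hermite certificate for a GENERAL cubic `g = a x³ + b x² + c x + d`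
(covers `f` with `(a,b,c,d) = (4,0,-q₂,-q₃)` on `σ` and `-f` with `(-4,0,q₂,q₃)` on `σ'`):
`d/dx (x^k √g) = (k x^{k-1} g + x^k g'/2)/√g`, and the numerator is
`a(k+3/2)x^{k+2} + b(k+1)x^{k+1} + c(k+½)x^k + d k x^{k-1}` — leading coefficient `a(k+3/2) ≠ 0`,
so moments of degree `≥ 2` reduce, with coefficients rational in `(a,b,c,d)`. -/
theorem monomial_certificate (a b c d x : ℝ) (k : ℕ) :
    (k : ℝ) * x ^ (k - 1) * (a * x ^ 3 + b * x ^ 2 + c * x + d)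
        + x ^ k * (3 * a * x ^ 2 + 2 * b * x + c) / 2
      = a * (k + 3 / 2) * x ^ (k + 2) + b * (k + 1) * x ^ (k + 1) + c * (k + 1 / 2) * x ^ k
        + d * k * x ^ (k - 1) := by
  rcases k with _ | j
  · simp; ring
  · simp only [Nat.add_sub_cancel, Nat.cast_succ]; ring

/-- STUB (first lemma of `oval-hermite-engine`, M). OVAL EXACT FORM for a general rational cubic:
on an open interval `(u, v)` on which `g > 0` with `g u = g v = 0`, the representation
`[(u,v), (Q'g + Q g'/2)/√g]` is a relation — ONE rule-3 instance over the base `ℝ⁰` with band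
`[u, v]` and primitive `Q √g` (ℚ-semialgebraic, continuous on `[u,v]`, vanishing at both ends,
derivative the integrand inside), then rule 1a drops the two null endpoints and the value-0 base
constant (`KZ.of_mem_relations_of_volume_eq_zero`, `KZ.of_mem_relations_of_eqOn_zero`).
`HermiteExactFormVanishes` (support 3412) is the instance `g = f`, `(u,v) = (e₃,e₂)`; the crux's
`σ'` is the instance `g = -f`, `(u,v) = (e₂,e₁)`. -/
theorem stub_ovalExactForm (a b c d : ℚ) (Q : Polynomial ℚ) (u v : ℝ) (huv : u < v) :
    let g : ℝ → ℝ := fun x => (a : ℝ) * x ^ 3 + (b : ℝ) * x ^ 2 + (c : ℝ) * x + (d : ℝ)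
    let g' : ℝ → ℝ := fun x => 3 * (a : ℝ) * x ^ 2 + 2 * (b : ℝ) * x + (c : ℝ)
    g u = 0 → g v = 0 → (∀ x ∈ Ioo u v, 0 < g x) →
    ∀ r : KZ.IntegralRep 1, r.domain = {p | u < p 0 ∧ p 0 < v} →
      EqOn r.integrand (fun p => ((Polynomial.derivative Q).aeval (p 0) * g (p 0)
        + Q.aeval (p 0) * g' (p 0) / 2) / Real.sqrt (g (p 0))) {p | u < p 0 ∧ p 0 < v} →
      KZ.of r ∈ KZ.relations := by
  sorry

/-- STUB (M, bookkeeping over `stub_ovalExactForm` + `monomial_certificate` by strong induction on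
`m`, or in one stroke from the Hermite decomposition `ℚ[x] = ℚ ⊕ ℚx ⊕ D_g(ℚ[x])`). OVAL REDUCTION:
every moment representation on the oval is congruent modulo relations to a rational rescaling
(`KZ.IntegralRep.constMul`, tree) of the two normal forms `1/√g`, `x/√g` on the same oval. -/
theorem stub_ovalReduction (a b c d : ℚ) (u v : ℝ) (huv : u < v) (m : ℕ) :
    let g : ℝ → ℝ := fun x => (a : ℝ) * x ^ 3 + (b : ℝ) * x ^ 2 + (c : ℝ) * x + (d : ℝ)
    let D : Set (Fin 1 → ℝ) := {p | u < p 0 ∧ p 0 < v}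
    a ≠ 0 → g u = 0 → g v = 0 → (∀ x ∈ Ioo u v, 0 < g x) →
    ∀ r r₀ r₁ : KZ.IntegralRep 1, r.domain = D → r₀.domain = D → r₁.domain = D →
      EqOn r.integrand (fun p => p 0 ^ m / Real.sqrt (g (p 0))) D →
      EqOn r₀.integrand (fun p => 1 / Real.sqrt (g (p 0))) D →
      EqOn r₁.integrand (fun p => p 0 / Real.sqrt (g (p 0))) D →
      ∃ (α β : ℚ) (hα : IsAlgebraic ℚ (α : ℝ)) (hβ : IsAlgebraic ℚ (β : ℝ)),
        KZ.of r - KZ.of (r₀.constMul (α : ℝ) hα) - KZ.of (r₁.constMul (β : ℝ) hβ) ∈ KZ.relations := by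
  sorry

end Summit.KontsevichZagierPeriods.KontsevichZagierPeriods.Cruxes.RealEllipticSectorKernel.Ideate1
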